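import Summits.NavierStokesRegularity.NavierStokesRegularity.Theorems.ForcedSymmetry.Negative.WithoutOseen

/-!
# Crux `ForcedSymmetry` (stmt-NavierStokesRegularity-4052), negative side: the vertex lemma needs its vertex in the closed end

Negative-side (cdisprove, D-0016, cycle 2) support lemma extracted from `Cruxes/ForcedSymmetry/Disproof.lean`
v7 §8, on stub 3 `stub_interiorVertexVanishing` of the picked line `time-anchor-bootstrap` (proved as
stated, p76364: a Type-I KNSS-mild ancient field annihilated on an end `t < T` by a rotated scaling
generator whose time vertex `θ < 0` lies in the closed end, `θ ≤ T`, vanishes on the end — by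
characteristics, using smoothness only).

`vertexOutsideEnd_false_without_H3`: the same statement with the Oseen clause H3 deleted (class
H1 ∧ H2 ∧ H4) AND the vertex allowed OUTSIDE the closed end (`T < θ < 0`) is FALSE.  Witness: the glued
parasitic soliton `vtxWit t x = vtxClock t • e₀`, `vtxClock = (−1 − t)^{-1/2}` on `t ≤ −2` (exactly
self-similar about the vertex `θ = −1`) capped smoothly by `Real.smoothTransition` before the vertex:
smooth on the whole slab, divergence free, `‖vtxWit‖ ≤ 2/√(−t)`, annihilated on `t < T = −2` by the
scaling generator about `(−1, 0)`, nonzero there.  So the elementary vertex lemma cannot reach vertices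
in `(T, 0)`: there any vanishing statement must use H3 (irrotational leaf: Tsai + the gauge on the end;
rotated leaf: the open bounded-profile RSS Liouville, as in stub 2b).
No statement of the route is changed; nothing here closes the item (`--supports`).
-/

noncomputable section

namespace Summit.NavierStokesRegularity.NavierStokesRegularity.Theorems.ForcedSymmetry.Negative

open MeasureTheory Set Filter Topology
open Literature.Analysis.FluidPDE Literature.Analysis.UnboundedOperators
open Summit.NavierStokesRegularity.NavierStokesRegularity.Theses.SymmetryModuliCount
open Summit.NavierStokesRegularity.NavierStokesRegularity.Theorems.MustSqueeze.Negative

/-! ## The glued parasitic soliton -/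

/-- The glue `vtxGlue t = (−1 − t)(1 − S(2(t+2))) + S(2(t+2))`, `S = Real.smoothTransition`: smooth,
`vtxGlue t = −1 − t` for `t ≤ −2`, `vtxGlue t = 1` for `t ≥ −3/2`, `vtxGlue ≥ 1/2` and `vtxGlue t ≥ (−t)/4` everywhere. -/
def vtxGlue (t : ℝ) : ℝ :=
  (-1 - t) * (1 - Real.smoothTransition (2 * (t + 2))) + Real.smoothTransition (2 * (t + 2))

/-- On the end `t ≤ −2` the glue is `−1 − t`. -/
theorem vtxGlue_of_le {t : ℝ} (ht : t ≤ -2) : vtxGlue t = -1 - t := by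
  have h0 : Real.smoothTransition (2 * (t + 2)) = 0 := Real.smoothTransition.zero_of_nonpos (by linarith)
  simp [vtxGlue, h0]

/-- Past the cap `t ≥ −3/2` the glue is `1`. -/
theorem vtxGlue_of_ge {t : ℝ} (ht : -3 / 2 ≤ t) : vtxGlue t = 1 := by
  have h1 : Real.smoothTransition (2 * (t + 2)) = 1 := Real.smoothTransition.one_of_one_le (by linarith)
  simp [vtxGlue, h1]

/-- `vtxGlue ≥ 1/2`. -/
theorem half_le_vtxGlue (t : ℝ) : 1 / 2 ≤ vtxGlue t := by
  rcases le_or_gt t (-3 / 2) with h | h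
  · have h0 := Real.smoothTransition.nonneg (2 * (t + 2))
    have h1 := Real.smoothTransition.le_one (2 * (t + 2))
    unfold vtxGlue
    nlinarith
  · rw [vtxGlue_of_ge h.le]; norm_num

/-- `vtxGlue > 0`. -/
theorem vtxGlue_pos (t : ℝ) : 0 < vtxGlue t := by linarith [half_le_vtxGlue t]

/-- `vtxGlue t ≥ (−t)/4` (the Type-I shape of the clock). -/
theorem neg_div_four_le_vtxGlue (t : ℝ) : -t / 4 ≤ vtxGlue t := by
  rcases le_or_gt t (-2) with h | h
  · rw [vtxGlue_of_le h]; linarith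
  · linarith [half_le_vtxGlue t]

/-- The glue is smooth. -/
theorem contDiff_vtxGlue : ContDiff ℝ (⊤ : ℕ∞) vtxGlue := by
  have hS : ContDiff ℝ (⊤ : ℕ∞) (fun t : ℝ => Real.smoothTransition (2 * (t + 2))) :=
    Real.smoothTransition.contDiff.comp (contDiff_const.mul (contDiff_id.add contDiff_const))
  have : vtxGlue = fun t => (-1 - t) * (1 - Real.smoothTransition (2 * (t + 2))) + Real.smoothTransition (2 * (t + 2)) := rfl
  rw [this]
  exact ((contDiff_const.sub contDiff_id).mul (contDiff_const.sub hS)).add hS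

/-- The glued clock `vtxClock t = vtxGlue(t)^{-1/2}`: equal to `(−1 − t)^{-1/2}` (self-similar about the vertex
`θ = −1`) on the end `t ≤ −2`, smooth and positive on the whole line, `vtxClock t ≤ 2/√(−t)` on `t < 0`. -/
def vtxClock (t : ℝ) : ℝ := (Real.sqrt (vtxGlue t))⁻¹

/-- The clock is smooth on the whole line. -/
theorem contDiff_vtxClock : ContDiff ℝ (⊤ : ℕ∞) vtxClock :=
  (contDiff_vtxGlue.sqrt fun t => (vtxGlue_pos t).ne').inv fun t => (Real.sqrt_pos.2 (vtxGlue_pos t)).ne'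

/-- The clock is positive. -/
theorem vtxClock_pos (t : ℝ) : 0 < vtxClock t := inv_pos.2 (Real.sqrt_pos.2 (vtxGlue_pos t))

/-- The clock obeys the Type-I rate with constant `2`. -/
theorem vtxClock_le {t : ℝ} (ht : t < 0) : vtxClock t ≤ 2 / Real.sqrt (-t) := by
  have hq : Real.sqrt (-t / 4) = Real.sqrt (-t) / 2 := by
    rw [Real.sqrt_div' _ (by norm_num : (0:ℝ) ≤ 4)]
    congr 1
    rw [show (4 : ℝ) = 2 ^ 2 by norm_num, Real.sqrt_sq (by norm_num : (0:ℝ) ≤ 2)]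
  have hpos : 0 < Real.sqrt (-t) / 2 := by
    have := Real.sqrt_pos.2 (show 0 < -t by linarith); linarith
  have hle : Real.sqrt (-t) / 2 ≤ Real.sqrt (vtxGlue t) := by
    rw [← hq]; exact Real.sqrt_le_sqrt (neg_div_four_le_vtxGlue t)
  calc vtxClock t = (Real.sqrt (vtxGlue t))⁻¹ := rfl
    _ ≤ (Real.sqrt (-t) / 2)⁻¹ := inv_anti₀ hpos hle
    _ = 2 / Real.sqrt (-t) := by rw [inv_div]

/-- Derivative of the clock on the end: for `t < −2`, `vtxClock' t = 1/(2 (−1−t) √(−1−t))`. -/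
theorem hasDerivAt_vtxClock {t : ℝ} (ht : t < -2) :
    HasDerivAt vtxClock (1 / (2 * (-1 - t) * Real.sqrt (-1 - t))) t := by
  have hg : vtxGlue t = -1 - t := vtxGlue_of_le ht.le
  have hlin : HasDerivAt (fun s : ℝ => -1 - s) (-1) t := by
    simpa using (hasDerivAt_id t).const_sub (-1)
  have hEq : vtxGlue =ᶠ[𝓝 t] fun s => -1 - s :=
    Filter.eventually_of_mem (Iio_mem_nhds ht) fun s hs => vtxGlue_of_le (le_of_lt hs)
  have hgl : HasDerivAt vtxGlue (-1) t := hlin.congr_of_eventuallyEq hEq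
  have hpos : 0 < -1 - t := by linarith
  have hsq : HasDerivAt (fun s => Real.sqrt (vtxGlue s)) ((-1) / (2 * Real.sqrt (vtxGlue t))) t :=
    hgl.sqrt (vtxGlue_pos t).ne'
  have hne : Real.sqrt (vtxGlue t) ≠ 0 := (Real.sqrt_pos.2 (vtxGlue_pos t)).ne'
  have hinv := hsq.inv hne
  have hval : -(-1 / (2 * Real.sqrt (vtxGlue t))) / Real.sqrt (vtxGlue t) ^ 2 = 1 / (2 * (-1 - t) * Real.sqrt (-1 - t)) := by
    rw [hg, Real.sq_sqrt hpos.le]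
    field_simp
  rw [hval] at hinv
  exact hinv

/-- The glued witness `vtxWit t x = vtxClock t • e₀` (constant in space). -/
def vtxWit (t : ℝ) (_x : EuclideanSpace ℝ (Fin 3)) : EuclideanSpace ℝ (Fin 3) := vtxClock t • e0

/-- H1: the witness is smooth. -/
theorem vtxWit_h1 : H1 vtxWit :=
  ((contDiff_vtxClock.comp contDiff_fst).smul contDiff_const).contDiffOn

/-- H2: the witness is divergence free (constant in space). -/
theorem vtxWit_h2 : H2 vtxWit := by
  intro t _ x
  have : vtxWit t = fun _ => vtxClock t • e0 := rfl
  simp [VectorCalculus.divergence, this]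

/-- H4: `‖vtxWit‖ ≤ 2/√(−t)`. -/
theorem vtxWit_h4 : H4 2 vtxWit := by
  intro t ht x
  have : ‖vtxWit t x‖ = vtxClock t := by
    simp [vtxWit, norm_smul, e0, abs_of_pos (vtxClock_pos t)]
  rw [this]
  exact vtxClock_le ht

/-- Time derivative of the witness on the end `t < −2`. -/
theorem timeDeriv_vtxWit {t : ℝ} (ht : t < -2) (x : EuclideanSpace ℝ (Fin 3)) :
    timeDeriv vtxWit t x = (1 / (2 * (-1 - t) * Real.sqrt (-1 - t))) • e0 :=
  ((hasDerivAt_vtxClock ht).smul_const e0).deriv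

/-- On the end the clock is `(−1 − t)^{-1/2}`. -/
theorem vtxClock_of_lt {t : ℝ} (ht : t < -2) : vtxClock t = (Real.sqrt (-1 - t))⁻¹ := by
  simp [vtxClock, vtxGlue_of_le ht.le]

/-- On the end `t < −2` the witness is annihilated by the scaling generator about the vertex
`(θ, x_c) = (−1, 0)` (`σ = 1`, `a = 0`, `A = 0`): `∇vtxWit·x + vtxWit + 2(t+1)∂ₜuc = 0`. -/
theorem vtxWit_generator {t : ℝ} (ht : t < -2) (x : EuclideanSpace ℝ (Fin 3)) :
    fderiv ℝ (vtxWit t) x ((0 : EuclideanSpace ℝ (Fin 3)) + (1 : ℝ) • x + (0 : EuclideanSpace ℝ (Fin 3) →L[ℝ] EuclideanSpace ℝ (Fin 3)) x)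
      + (1 : ℝ) • vtxWit t x + (2 * (1 : ℝ) * (t - (-1))) • timeDeriv vtxWit t x
      - (0 : EuclideanSpace ℝ (Fin 3) →L[ℝ] EuclideanSpace ℝ (Fin 3)) (vtxWit t x) = 0 := by
  have hfd : fderiv ℝ (vtxWit t) x = 0 := by
    have : vtxWit t = fun _ => vtxClock t • e0 := rfl
    rw [this]; exact fderiv_const_apply _
  rw [hfd, timeDeriv_vtxWit ht x]
  simp only [zero_apply, zero_add, one_smul, sub_zero, vtxWit, vtxClock_of_lt ht, smul_smul, ← add_smul,
    one_mul]
  have hpos : 0 < -1 - t := by linarith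
  have hs : Real.sqrt (-1 - t) ≠ 0 := (Real.sqrt_pos.2 hpos).ne'
  have : (Real.sqrt (-1 - t))⁻¹ + 2 * 1 * (t - -1) * (1 / (2 * (-1 - t) * Real.sqrt (-1 - t))) = 0 := by
    field_simp
    ring
  rw [this, zero_smul]

/-- The witness does not vanish on the end. -/
theorem vtxWit_ne_zero : vtxWit (-3) 0 ≠ 0 := by
  simp [vtxWit, e0, (vtxClock_pos (-3)).ne']

/-- Stub 3 of line `time-anchor-bootstrap` (interior-vertex vanishing) with the Oseen clause H3 deleted
AND the vertex allowed OUTSIDE the closed end (`T < θ < 0` instead of `θ ≤ T`). -/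
def VertexOutsideEndVanishingWithoutH3 : Prop :=
  ∀ (C : ℝ) (u : ℝ → EuclideanSpace ℝ (Fin 3) → EuclideanSpace ℝ (Fin 3)), H1 u → H2 u → H4 C u →
    ∀ (a : EuclideanSpace ℝ (Fin 3)) (σ : ℝ) (A : EuclideanSpace ℝ (Fin 3) →L[ℝ] EuclideanSpace ℝ (Fin 3)) (θ T : ℝ),
      (∀ x, inner ℝ (A x) x = 0) → σ ≠ 0 → θ < 0 → T < θ → T ≤ 0 →
      (∀ t < T, ∀ x, fderiv ℝ (u t) x (a + σ • x + A x) + σ • u t x +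
        (2 * σ * (t - θ)) • timeDeriv u t x - A (u t x) = 0) →
      ∀ t < T, ∀ x, u t x = 0

/-- **Tightness of the vertex lemma.** In the H3-free class (smooth, divergence free, Type-I) the
interior-vertex vanishing statement is FALSE as soon as the vertex `θ < 0` is allowed to lie OUTSIDE
the closed end `t ≤ T` on which the generator identity holds: the glued parasitic soliton
`vtxWit t x = vtxClock t • e₀`, `vtxClock = (−1 − t)^{-1/2}` on `t ≤ −2` and smoothly capped (`Real.smoothTransition`)
before the vertex `θ = −1`, is smooth on the whole slab, divergence free, obeys `‖vtxWit‖ ≤ 2/√(−t)`, is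
annihilated on `t < T = −2` by the scaling generator about `(−1, 0)`, and does not vanish there.
So the elementary characteristic argument of stub 3 (which uses H1 only and runs INTO the vertex)
genuinely needs `θ ≤ T`; for a vertex in `(T, 0)` any vanishing statement must use the Oseen clause H3
(irrotational leaf: Tsai + the gauge on the end; rotated leaf: the open RSS-Liouville, as in stub 2b). -/
theorem vertexOutsideEnd_false_without_H3 : ¬ VertexOutsideEndVanishingWithoutH3 := by
  intro h
  have h0 := h 2 vtxWit vtxWit_h1 vtxWit_h2 vtxWit_h4 0 1 0 (-1) (-2) (fun x => by simp) one_ne_zero (by norm_num)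
    (by norm_num) (by norm_num) (fun t ht x => vtxWit_generator ht x) (-3) (by norm_num) 0
  exact vtxWit_ne_zero h0

end Summit.NavierStokesRegularity.NavierStokesRegularity.Theorems.ForcedSymmetry.Negative
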